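import Summits.Ventures.CertifiedArithmetic.LowPrec.DoubleRoundingFMABinade

/-!
# Double rounding of the FMA — the first binade above `W`: a `J`-independent coarse criterion
# and the row `(m, n) = (16, 31)` in the kernel

HONEST FRAMING: certified error envelopes and provably optimal rounding/accumulation schemes for
low-precision formats under stated cost models; every table by two implementations; no hardware
or vendor claims.

`fmaBinadeSlipTest m n J` (`DoubleRoundingFMABinade.lean`) decides the FMA of an `(m+1)`-digit
source with largest value `(2^m + J)·2^(k+1)` quanta through an `(m+n+1)`-digit register
(THEOREM D-fma-M♯, `dFma_binade_iff` in `…BinadeIff.lean`).  A candidate `(j, e)` of the test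
needs `|e·2^n + σ_j|` to split into two `P_φ`-digit significands AND the addend significand
`w = 2^(m+1) + 2j + 1 - e` to be even once `w ≥ 2^(m+1)`.  Since `|e·2^n - 1| = |(-e)·2^n + 1|`,
only the numbers `N_e = |e·2^n + 1|`, `|e| ≤ 2^(2m+2-n)`, occur, and the following COARSE
CRITERION — a plain proposition, independent of `J` — kills every candidate
(`fmaBinadeSlipTest_eq_false_of_coarse`):

  for every `|e| ≤ 2^(2m+2-n)`: if `N_e` splits then `e` is even and `-3 ≤ e ≤ 1`

(then `w` is odd and `≥ 2^(m+1)` for every `j` of the matching parity).  So NO source top in the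
first binade above `W` slips.  To DISCHARGE the criterion in the kernel for a large row we do
not evaluate `twoSigTest` (`List.range (2^P)`, too deep for the kernel at `P = 17`) but a capped
search over the odd candidates `c ∈ (N / 2^P, hi)`, `hi² > N` (`twoSigSearch`, balanced
recursion `anyR`), which is COMPLETE (`twoSigSearch_eq_true_of`: a splitting `N = a·b` has
`c = min a b` odd, `c² ≤ N`, `N < c·2^P`); one ENTRY `fmaBinadeCoarseEntry m n e hi` checks the
cap and the criterion for one `e` (`coarse_of_entry`).

THE ROW `(16, 31)` (`P_φ = 17`, `P_ψ = 48`; with `(12, 23)` one of the two rows with `m ≤ 16`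
where THEOREM D-fma-M's side condition `fmaMidPairTest` fails): the 17 entries `e = -8 … 8`
hold in the kernel (`coarseEntry_16_31_*`; ≈ 1.7·10^5 trial divisions in all; the entries
`e = -2` — `2^32 - 1 = 65535·65537` splits — and `e = 0` pass through the parity clause, every
other `N_e` has no divisor in range), hence `coarse_16_31` and

  `fmaBinadeSlip_16_31 : ∀ J, fmaBinadeSlipTest 16 31 J = false`

— the whole first binade above `W` is innocuous on that row, as the cell's implementation A
(`code/enum/fma_binade_law.py`: residue solver + factor table) found; with `dFma_binade_iff`
this is `DFma φ ψ` for every pair of records of the row (in the regime, top in the first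
binade).  Implementation A → `DOUBLE-ROUNDING-FMA.md` §14,
`certs/enum/DOUBLE-ROUNDING-FMA-BINADE.json`.  No hardware or vendor claims.
-/

namespace Summit.Ventures.CertifiedArithmetic

/-! ## §1 A balanced bounded search -/

/-- `anyR f s l d`: `f` holds somewhere on `[s, s + l)` — balanced binary recursion with fuel `d`
(faithful when `l ≤ 2^d`), so that the kernel evaluates long ranges at logarithmic recursion
depth. [folklore] -/
def anyR (f : ℕ → Bool) : ℕ → ℕ → ℕ → Bool
  | s, l, 0 => decide (l = 1) && f s
  | s, l, d + 1 =>
    if l ≤ 1 then decide (l = 1) && f s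
    else anyR f s (l / 2) d || anyR f (s + l / 2) (l - l / 2) d

/-- Specification of `anyR`. [folklore] -/
theorem anyR_eq_true_iff (f : ℕ → Bool) :
    ∀ d s l : ℕ, l ≤ 2 ^ d →
      (anyR f s l d = true ↔ ∃ a, s ≤ a ∧ a < s + l ∧ f a = true) := by
  have base : ∀ s l : ℕ, l ≤ 1 →
      ((decide (l = 1) && f s) = true ↔ ∃ a, s ≤ a ∧ a < s + l ∧ f a = true) := by
    intro s l hl
    rw [Bool.and_eq_true, decide_eq_true_eq]
    constructor
    · rintro ⟨h1, h2⟩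
      exact ⟨s, le_rfl, by omega, h2⟩
    · rintro ⟨a, h1, h2, h3⟩
      obtain rfl : a = s := by omega
      exact ⟨by omega, h3⟩
  intro d
  induction d with
  | zero =>
    intro s l hl
    exact base s l (by simpa using hl)
  | succ d ih =>
    intro s l hl
    rw [pow_succ] at hl
    simp only [anyR]
    by_cases h1 : l ≤ 1
    · rw [if_pos h1]
      exact base s l h1
    · rw [if_neg h1, Bool.or_eq_true, ih s (l / 2) (by omega),
        ih (s + l / 2) (l - l / 2) (by omega)]
      constructor
      · rintro (⟨a, ha, hb, hf⟩ | ⟨a, ha, hb, hf⟩)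
        · exact ⟨a, ha, by omega, hf⟩
        · exact ⟨a, by omega, by omega, hf⟩
      · rintro ⟨a, ha, hb, hf⟩
        rcases lt_or_ge a (s + l / 2) with h | h
        · exact Or.inl ⟨a, ha, h, hf⟩
        · exact Or.inr ⟨a, h, by omega, hf⟩

/-- `twoSigSearch P n lo hi`: some ODD `c = 2i + 1` with `lo / 2 ≤ i < hi / 2` divides `n` with
cofactor `< 2^P` (`n < c·2^P`).  Used with `lo = n / 2^P` and a cap `hi`, `hi² > n`.
[this packet] -/
def twoSigSearch (P n lo hi : ℕ) : Bool :=
  anyR (fun i => Nat.beq (n % (2 * i + 1)) 0 && Nat.blt n ((2 * i + 1) * 2 ^ P))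
    (lo / 2) (hi / 2 - lo / 2) (hi / 2 - lo / 2)

/-- A hit: an odd-numbered factorisation `n = c·d`, `c ≤ d < 2^P`, below the cap is found.
[this packet] -/
theorem twoSigSearch_eq_true_of_mul {P n hi c d : ℕ} (hodd : n % 2 = 1) (hcap : n < hi * hi)
    (hcd : c * d = n) (hle : c ≤ d) (hd : d < 2 ^ P) :
    twoSigSearch P n (n / 2 ^ P) hi = true := by
  have hc0 : 0 < c := by
    rcases Nat.eq_zero_or_pos c with h | h
    · rw [h, zero_mul] at hcd; omega
    · exact h
  have hcodd : c % 2 = 1 :=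
    Nat.odd_iff.mp (Nat.odd_mul.mp (hcd ▸ Nat.odd_iff.mpr hodd :)).1
  have hclt : n < c * 2 ^ P := by
    calc n = c * d := hcd.symm
      _ < c * 2 ^ P := Nat.mul_lt_mul_of_pos_left hd hc0
  have hlo : n / 2 ^ P < c := (Nat.div_lt_iff_lt_mul (by positivity)).mpr hclt
  have hchi : c < hi := by
    have : c * c < hi * hi :=
      calc c * c ≤ c * d := Nat.mul_le_mul_left c hle
        _ = n := hcd
        _ < hi * hi := hcap
    exact Nat.mul_self_lt_mul_self_iff.mp this
  have hc2 : 2 * (c / 2) + 1 = c := by omega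
  unfold twoSigSearch
  rw [anyR_eq_true_iff _ _ _ _ (le_of_lt Nat.lt_two_pow_self)]
  refine ⟨c / 2, by omega, by omega, ?_⟩
  rw [hc2, Bool.and_eq_true, Nat.beq_eq, Nat.blt_eq]
  exact ⟨Nat.mod_eq_zero_of_dvd ⟨d, hcd.symm⟩, hclt⟩

/-- COMPLETENESS of the capped odd search: for odd `n < hi²`, a two-significand factorisation
(`twoSigTest`) is found. [this packet] -/
theorem twoSigSearch_eq_true_of {P n hi : ℕ} (hodd : n % 2 = 1) (hcap : n < hi * hi)
    (ht : twoSigTest P n = true) : twoSigSearch P n (n / 2 ^ P) hi = true := by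
  rw [twoSigTest, List.any_eq_true] at ht
  obtain ⟨a, ha, hg⟩ := ht
  rw [List.mem_range] at ha
  simp only [Bool.and_eq_true, decide_eq_true_eq] at hg
  obtain ⟨⟨ha0, hmod⟩, hlt⟩ := hg
  obtain ⟨b, hab⟩ := Nat.dvd_of_mod_eq_zero hmod
  have hb : b < 2 ^ P := by
    by_contra h
    have : a * 2 ^ P ≤ a * b := Nat.mul_le_mul_left a (by omega)
    rw [hab] at hlt
    exact absurd hlt (not_lt.mpr this)
  rcases le_total a b with h | h
  · exact twoSigSearch_eq_true_of_mul hodd hcap hab.symm h hb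
  · exact twoSigSearch_eq_true_of_mul hodd hcap (by rw [hab, mul_comm]) h ha

/-! ## §2 The coarse criterion -/

/-- One ENTRY of the coarse criterion: for the offset count `e`, with `N = |e·2^n + 1|` and a cap
`hi` (`hi² > N` is checked), either the capped search finds no two-significand factorisation of
`N` or `e` is even with `-3 ≤ e ≤ 1`. [this packet] -/
def fmaBinadeCoarseEntry (m n : ℕ) (e : ℤ) (hi : ℕ) : Bool :=
  let N := (e * 2 ^ n + 1).natAbs
  Nat.blt N (hi * hi) &&
    (!twoSigSearch (m + 1) N (N / 2 ^ (m + 1)) hi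
      || (decide (e % 2 = 0) && decide (e ≤ 1) && decide (-3 ≤ e)))

/-- Soundness of an entry: it discharges the coarse criterion at `e` (`n ≥ 1` makes `N` odd).
[this packet] -/
theorem coarse_of_entry {m n : ℕ} {e : ℤ} {hi : ℕ} (hn : 1 ≤ n)
    (h : fmaBinadeCoarseEntry m n e hi = true)
    (ht : twoSigTest (m + 1) ((e * 2 ^ n + 1).natAbs) = true) :
    e % 2 = 0 ∧ e ≤ 1 ∧ -3 ≤ e := by
  have hodd : (e * 2 ^ n + 1).natAbs % 2 = 1 := by
    have h2 : (2:ℤ) ^ n = 2 * 2 ^ (n - 1) := by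
      rw [← pow_succ']; congr 1; omega
    have : Odd (e * 2 ^ n + 1) := ⟨e * 2 ^ (n - 1), by rw [h2]; ring⟩
    exact Nat.odd_iff.mp (Int.natAbs_odd.mpr this)
  unfold fmaBinadeCoarseEntry at h
  simp only [Bool.and_eq_true, Bool.or_eq_true, Bool.not_eq_true', Nat.blt_eq,
    decide_eq_true_eq] at h
  obtain ⟨hcap, h | h⟩ := h
  · rw [twoSigSearch_eq_true_of hodd hcap ht] at h
    exact Bool.noConfusion h
  · exact ⟨h.1.1, h.1.2, h.2⟩

/-- THE COARSE CRITERION (as a proposition) ⟹ no source top in the first binade above `W`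
slips, whatever `J`: every candidate `(j, e)` has a number `|e·2^n + σ_j| = N_(σ_j·e)` that does
not split, or `w = 2^(m+1) + 2j + 1 - e` odd and `≥ 2^(m+1)` (`e` even; `e ≤ 1` for even `j`,
`e ≤ 3` for odd `j ≥ 1`). [this packet] -/
theorem fmaBinadeSlipTest_eq_false_of_coarse {m n : ℕ}
    (h : ∀ e : ℤ, |e| ≤ 2 ^ (2 * m + 2 - n) →
      twoSigTest (m + 1) ((e * 2 ^ n + 1).natAbs) = true → e % 2 = 0 ∧ e ≤ 1 ∧ -3 ≤ e)
    (J : ℕ) : fmaBinadeSlipTest m n J = false := by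
  rw [Bool.eq_false_iff]
  intro ht
  unfold fmaBinadeSlipTest at ht
  rw [List.any_eq_true] at ht
  obtain ⟨j, -, ht⟩ := ht
  rw [List.any_eq_true] at ht
  obtain ⟨i, hi, ht⟩ := ht
  rw [List.mem_range] at hi
  have hE : (((2 ^ (2 * m + 2 - n) : ℕ) : ℤ)) = (2:ℤ) ^ (2 * m + 2 - n) := by push_cast; rfl
  set e : ℤ := (i : ℤ) - 2 ^ (2 * m + 2 - n) with he_def
  have he : |e| ≤ 2 ^ (2 * m + 2 - n) := by
    rw [← hE, abs_le]; constructor <;> omega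
  unfold fmaBinadeCond at ht
  simp only [Bool.and_eq_true, Bool.or_eq_true, decide_eq_true_eq] at ht
  obtain ⟨⟨⟨-, -⟩, h3⟩, h4⟩ := ht
  have h2m : (2:ℤ) ^ (m + 1) = 2 * 2 ^ m := by ring
  by_cases hj : j % 2 = 0
  · rw [if_pos hj] at h4
    obtain ⟨he2, hle, -⟩ := h e he h4
    rcases h3 with h3 | h3 <;> omega
  · rw [if_neg hj] at h4
    have h4' : twoSigTest (m + 1) ((-e * 2 ^ n + 1).natAbs) = true := by
      rw [show -e * 2 ^ n + 1 = -(e * 2 ^ n + -1) by ring, Int.natAbs_neg]; exact h4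
    obtain ⟨he2, hle, hge⟩ := h (-e) (by rwa [abs_neg]) h4'
    rcases h3 with h3 | h3 <;> omega

/-! ## §3 The row `(16, 31)` in the kernel -/

/-- Entry `e = -8` of the row `(16, 31)`: `N = 17179869183`, cap `131072`. [this packet] -/
theorem coarseEntry_16_31_n8 : fmaBinadeCoarseEntry 16 31 (-8) 131072 = true := by
  decide +kernel

/-- Entry `e = -7` of the row `(16, 31)`: `N = 15032385535`, cap `122607`. [this packet] -/
theorem coarseEntry_16_31_n7 : fmaBinadeCoarseEntry 16 31 (-7) 122607 = true := by
  decide +kernel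

/-- Entry `e = -6` of the row `(16, 31)`: `N = 12884901887`, cap `113512`. [this packet] -/
theorem coarseEntry_16_31_n6 : fmaBinadeCoarseEntry 16 31 (-6) 113512 = true := by
  decide +kernel

/-- Entry `e = -5` of the row `(16, 31)`: `N = 10737418239`, cap `103622`. [this packet] -/
theorem coarseEntry_16_31_n5 : fmaBinadeCoarseEntry 16 31 (-5) 103622 = true := by
  decide +kernel

/-- Entry `e = -4` of the row `(16, 31)`: `N = 8589934591`, cap `92682`. [this packet] -/
theorem coarseEntry_16_31_n4 : fmaBinadeCoarseEntry 16 31 (-4) 92682 = true := by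
  decide +kernel

/-- Entry `e = -3` of the row `(16, 31)`: `N = 6442450943`, cap `80265`. [this packet] -/
theorem coarseEntry_16_31_n3 : fmaBinadeCoarseEntry 16 31 (-3) 80265 = true := by
  decide +kernel

/-- Entry `e = -2` of the row `(16, 31)`: `N = 4294967295`, cap `65536`. [this packet] -/
theorem coarseEntry_16_31_n2 : fmaBinadeCoarseEntry 16 31 (-2) 65536 = true := by
  decide +kernel

/-- Entry `e = -1` of the row `(16, 31)`: `N = 2147483647`, cap `46341`. [this packet] -/
theorem coarseEntry_16_31_n1 : fmaBinadeCoarseEntry 16 31 (-1) 46341 = true := by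
  decide +kernel

/-- Entry `e = 0` of the row `(16, 31)`: `N = 1`, cap `2`. [this packet] -/
theorem coarseEntry_16_31_z0 : fmaBinadeCoarseEntry 16 31 0 2 = true := by
  decide +kernel

/-- Entry `e = 1` of the row `(16, 31)`: `N = 2147483649`, cap `46341`. [this packet] -/
theorem coarseEntry_16_31_p1 : fmaBinadeCoarseEntry 16 31 1 46341 = true := by
  decide +kernel

/-- Entry `e = 2` of the row `(16, 31)`: `N = 4294967297`, cap `65537`. [this packet] -/
theorem coarseEntry_16_31_p2 : fmaBinadeCoarseEntry 16 31 2 65537 = true := by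
  decide +kernel

/-- Entry `e = 3` of the row `(16, 31)`: `N = 6442450945`, cap `80265`. [this packet] -/
theorem coarseEntry_16_31_p3 : fmaBinadeCoarseEntry 16 31 3 80265 = true := by
  decide +kernel

/-- Entry `e = 4` of the row `(16, 31)`: `N = 8589934593`, cap `92682`. [this packet] -/
theorem coarseEntry_16_31_p4 : fmaBinadeCoarseEntry 16 31 4 92682 = true := by
  decide +kernel

/-- Entry `e = 5` of the row `(16, 31)`: `N = 10737418241`, cap `103622`. [this packet] -/
theorem coarseEntry_16_31_p5 : fmaBinadeCoarseEntry 16 31 5 103622 = true := by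
  decide +kernel

/-- Entry `e = 6` of the row `(16, 31)`: `N = 12884901889`, cap `113512`. [this packet] -/
theorem coarseEntry_16_31_p6 : fmaBinadeCoarseEntry 16 31 6 113512 = true := by
  decide +kernel

/-- Entry `e = 7` of the row `(16, 31)`: `N = 15032385537`, cap `122607`. [this packet] -/
theorem coarseEntry_16_31_p7 : fmaBinadeCoarseEntry 16 31 7 122607 = true := by
  decide +kernel

/-- Entry `e = 8` of the row `(16, 31)`: `N = 17179869185`, cap `131073`. [this packet] -/
theorem coarseEntry_16_31_p8 : fmaBinadeCoarseEntry 16 31 8 131073 = true := by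
  decide +kernel

/-- `(m, n) = (16, 31)`: the coarse criterion holds — of the numbers `|e·2^31 + 1|`, `|e| ≤ 8`,
only `2^32 - 1 = 65535·65537` (`e = -2`) and `1` (`e = 0`) split into two 17-digit
significands, both with `e` even and `-3 ≤ e ≤ 1`. [this packet; implementation A:
`fma_binade_law.py` Part 3] -/
theorem coarse_16_31 (e : ℤ) (he : |e| ≤ 2 ^ (2 * 16 + 2 - 31))
    (ht : twoSigTest (16 + 1) ((e * 2 ^ 31 + 1).natAbs) = true) :
    e % 2 = 0 ∧ e ≤ 1 ∧ -3 ≤ e := by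
  have h31 : 1 ≤ 31 := by norm_num
  norm_num at he
  obtain ⟨h1, h2⟩ := abs_le.mp he
  interval_cases e
  · exact coarse_of_entry h31 coarseEntry_16_31_n8 ht
  · exact coarse_of_entry h31 coarseEntry_16_31_n7 ht
  · exact coarse_of_entry h31 coarseEntry_16_31_n6 ht
  · exact coarse_of_entry h31 coarseEntry_16_31_n5 ht
  · exact coarse_of_entry h31 coarseEntry_16_31_n4 ht
  · exact coarse_of_entry h31 coarseEntry_16_31_n3 ht
  · exact coarse_of_entry h31 coarseEntry_16_31_n2 ht
  · exact coarse_of_entry h31 coarseEntry_16_31_n1 ht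
  · exact coarse_of_entry h31 coarseEntry_16_31_z0 ht
  · exact coarse_of_entry h31 coarseEntry_16_31_p1 ht
  · exact coarse_of_entry h31 coarseEntry_16_31_p2 ht
  · exact coarse_of_entry h31 coarseEntry_16_31_p3 ht
  · exact coarse_of_entry h31 coarseEntry_16_31_p4 ht
  · exact coarse_of_entry h31 coarseEntry_16_31_p5 ht
  · exact coarse_of_entry h31 coarseEntry_16_31_p6 ht
  · exact coarse_of_entry h31 coarseEntry_16_31_p7 ht
  · exact coarse_of_entry h31 coarseEntry_16_31_p8 ht

/-- `(16, 31)`: NO source top in the first binade above `W` slips (`J ≤ 2^16` is the meaningful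
range; the statement holds for every `J`). [this packet] -/
theorem fmaBinadeSlip_16_31 (J : ℕ) : fmaBinadeSlipTest 16 31 J = false :=
  fmaBinadeSlipTest_eq_false_of_coarse coarse_16_31 J

end Summit.Ventures.CertifiedArithmetic
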